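import Literature.NumberTheory.GaloisCohomology.LocalInvariantMapEvaluation
import Literature.NumberTheory.GaloisRepresentations.CyclotomicLevels
import Literature.NumberTheory.GaloisRepresentations.DecompositionGroupOfCompletion
import Literature.NumberTheory.GaloisRepresentations.GaloisSubgroups
import Literature.NumberTheory.GaloisRepresentations.ArtinRestriction
import Literature.NumberTheory.Automorphic.AdicCompletionResidueCard
import HarnessLib

/-!
# The `p`-primary quotient of the mod-`q` cyclotomic character

The auxiliary cyclic character of Tate's proof of the reciprocity law `∑_v inv_v = 0` on
`H²(Γ_K, μ_{p^m})` (Cassels–Fröhlich VII §10, Step 3 = §10.5): for an auxiliary prime `q`, the `p`-power-degree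
subextension of `K(μ_q)/K` and its character `ψ : Γ_K ↠ ℤ/p^e`, unramified outside `q`, whose value
on a Frobenius at `v ∣ p` has large order when `p` has large `p`-power order modulo `q`.  Supplied in
the tree's vocabulary (`CyclicCharacter`, `modNCyclotomicCharacter`, `absInertia`, `IsAbsArithFrob`,
`absGaloisRestrict K (v.adicCompletion K)`) for the (F1) campaign of `pub/bsd-cn100` (node T-pre).

## Main statements

* `CyclicCharacter.exists_ker_eq_galFixing` — every cyclic character `ψ` of `Γ_K` (`char K = 0`)
  has `ker ψ = Gal(K̄/L)` for a finite abelian Galois `L ⊆ K̄` (Krull correspondence); this is the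
  shape `(L, hker)` consumed by the tree's `sum_localInvariantMap_localization_cupProduct_δ₀_eq_zero`.
* `exists_cyclicCharacter_pPrimary_cyclotomic` — for primes `p, q` a cyclic character
  `ψ : Γ_K ↠ ℤ/p^e` factoring through `χ_q` with `addOrderOf (ψ σ) = p^a` whenever
  `orderOf (χ_q σ) = p^a`.
* `modNCyclotomicCharacter_absGaloisRestrict_eq_one_of_mem_absInertia` — `χ_q` kills `res(I_{K_v})`
  for `v ∤ q`; `coe_modNCyclotomicCharacter_absGaloisRestrict_of_isAbsArithFrob` — `χ_q(res φ) = N(v)`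
  for an arithmetic Frobenius `φ ∈ Γ_{K_v}`, `v ∤ q`.
* `exists_residueCard_eq_prime_pow` — `N(v) = p^f`, `f ≥ 1`, for `v ∣ p`;
  `exists_orderOf_modNCyclotomicCharacter_absGaloisRestrict_eq_prime_pow` — if `p` has order `p^T`
  modulo `q` and `N(v) ≤ B` then `χ_q(res φ)` has order `p^a` with `a ≥ T − B`.

## References

* J. Tate, *Global class field theory*, in Cassels–Fröhlich, *Algebraic Number Theory* (1967),
  Ch. VII §10 (proof of the reciprocity law), §10.5 (Step 3: cyclic cyclotomic extensions; PDF
  pp. 230–231 of the held copy `book:editornd-algebraic-number-theory`). [CasselsFrohlichANT1967]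
* J. Neukirch, *Algebraic Number Theory* (1999), Ch. I §8 (8.2) (inertia degrees); Ch. II §7
  Prop. (7.12) (`K(ζ_n)/K` for `p ∤ n`: unramified, Frobenius `ζ ↦ ζ^q`, degree = order of `q` mod `n`),
  §9 Prop. (9.6); Ch. IV §1 Thm. (1.2) (checked in the held copy `book:bynd-algebraic-number-theory`,
  PDF pp. 50, 149, 159, 243). [NeukirchANT1999]
-/

noncomputable section

open CategoryTheory Function NumberField IsDedekindDomain Field
open scoped NumberField

universe u

namespace Literature.NumberTheory.GaloisCohomology

open Literature.NumberTheory.GaloisRepresentations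
open Literature.NumberTheory.GaloisRepresentations.LocalWeilDatum
open Literature.NumberTheory.GaloisRepresentations.IsNonarchimedeanLocalField

/-! ### §1. The field cut out by a cyclic character -/

section KerField

variable {K : Type u} [Field K] [CharZero K] {N : ℕ}

/-- **The fixed field of the kernel of a cyclic character.**  For a cyclic character
`ψ : Γ_K ↠ ℤ/N` of a field `K` of characteristic `0`, the fixed field `L = K̄^{ker ψ}` is a finite
abelian (indeed cyclic) Galois extension of `K` inside `K̄` with `Gal(K̄/L) = ker ψ` (Krull's Galois
correspondence for the open normal subgroup `ker ψ`, `fixingSubgroup_fixedField_of_isOpen`; the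
Galois group `Gal(L/K) ≅ Γ_K / ker ψ ↪ ℤ/N` is commutative).
Ref: Neukirch, *Algebraic Number Theory* (1999), Ch. IV §1 Thm. (1.2).
[cite: NeukirchANT1999, Ch. IV §1 Thm. (1.2)] -/
theorem CyclicCharacter.exists_ker_eq_galFixing (ψ : CyclicCharacter (absoluteGaloisGroup K) N) :
    ∃ (L : IntermediateField K (AlgebraicClosure K)) (_ : FiniteDimensional K L)
      (_ : IsAbelianGalois K L), ψ.ker = galFixing K L := by
  haveI : IsGalois K (AlgebraicClosure K) := {}
  set H : Subgroup (absoluteGaloisGroup K) := ψ.ker with hHdef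
  have hopen : IsOpen (H : Set (absoluteGaloisGroup K)) := ψ.isOpen_ker
  set L : IntermediateField K (AlgebraicClosure K) := IntermediateField.fixedField H with hLdef
  have hLH : L.fixingSubgroup = H := fixingSubgroup_fixedField_of_isOpen H hopen
  haveI : FiniteDimensional K L := finiteDimensional_fixedField_of_isOpen H hopen
  haveI : IsGalois K L := by
    rw [← InfiniteGalois.normal_iff_isGalois, hLH, hHdef]
    exact CyclicCharacter.normal_ker ψ
  have hgal : galFixing K L = ψ.ker := by
    ext σ
    rw [mem_galFixing_iff]
    have h1 := mem_fixingSubgroup_iff_forall_smul L σ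
    rw [hLH] at h1
    exact ⟨fun h => h1.mpr fun x => h x x.2, fun h x hx => (h1.mp h) ⟨x, hx⟩⟩
  haveI : IsMulCommutative (L ≃ₐ[K] L) := by
    refine ⟨⟨fun a b => ?_⟩⟩
    obtain ⟨σ, rfl⟩ := resGal_surjective L a
    obtain ⟨τ, rfl⟩ := resGal_surjective L b
    rw [← commutatorElement_eq_one_iff_mul_comm, commutatorElement_def, ← map_inv, ← map_inv,
      ← map_mul, ← map_mul, ← map_mul, ← MonoidHom.mem_ker, ker_resGal, hgal, CyclicCharacter.mem_ker,
      ψ.map_mul, ψ.map_mul, ψ.map_mul, ψ.map_inv, ψ.map_inv]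
    abel
  haveI : IsAbelianGalois K L := ⟨⟩
  exact ⟨L, inferInstance, inferInstance, hgal.symm⟩

end KerField

/-! ### §2. The `p`-primary quotient character of `K(μ_q)/K` -/

section PPrimary

variable (K : Type u) [Field K] (q p : ℕ) [hq : Fact q.Prime] [hp : Fact p.Prime] [NeZero (q : K)]

/-- **The `p`-primary quotient of the mod-`q` cyclotomic character.**  For primes `p, q` (`q ≠ 0` in
`K`) there is a cyclic character `ψ : Γ_K ↠ ℤ/p^e` — the projection of
`χ_q : Γ_K → Gal(K(μ_q)/K) ↪ (ℤ/q)^×` onto the `p`-Sylow subgroup of its (cyclic) image, composed with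
an isomorphism of that cyclic `p`-group with `ℤ/p^e` — such that

* `ψ` factors through `χ_q` (so `ψ` is trivial on `Gal(K̄/K(μ_q))`, hence unramified away from `q`);
* `ψ σ` has additive order `p^a` whenever `χ_q σ` has (multiplicative) order `p^a`: on elements of
  `p`-power order the projection to the `p`-Sylow subgroup is injective.

Construction: `ψ = log ∘ (χ_q)^{h'}` with `h'` the prime-to-`p` part of `#(ℤ/q)^×` (`ordCompl[p]`),
`log : (χ_q^{h'})(Γ_K) ≅ ℤ/p^e` (`zmodCyclicMulEquiv`; the image is a cyclic `p`-group).  This is the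
character of the auxiliary cyclic cyclotomic extension in Tate's proof of the reciprocity law for
`H²(μ_n)` (the `p`-power-degree subfield of `K(μ_q)`).
Ref: Tate, in Cassels–Fröhlich (1967), Ch. VII §10.5; Neukirch, *Algebraic Number Theory* (1999),
Ch. II §7 Prop. (7.12) (local structure of `K(ζ_q)/K`). [cite: CasselsFrohlichANT1967, Ch. VII §10.5 (Step 3)] -/
theorem exists_cyclicCharacter_pPrimary_cyclotomic :
    ∃ (e : ℕ) (ψ : CyclicCharacter (absoluteGaloisGroup K) (p ^ e)),
      (∀ σ, modNCyclotomicCharacter K q σ = 1 → ψ σ = 0) ∧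
      (∀ σ (a : ℕ), orderOf (modNCyclotomicCharacter K q σ) = p ^ a → addOrderOf (ψ σ) = p ^ a) := by
  classical
  have hpp : p.Prime := hp.out
  set χ := modNCyclotomicCharacter K q with hχ
  -- the exponent of `(ℤ/q)^×` and its prime-to-`p` part `h'`
  set r : ℕ := Nat.card (ZMod q)ˣ with hr
  have hr0 : r ≠ 0 := by rw [hr]; exact Nat.card_pos.ne'
  have hpow : ∀ x : (ZMod q)ˣ, x ^ r = 1 := fun x => by rw [hr]; exact pow_card_eq_one'
  set h' : ℕ := ordCompl[p] r with hh'
  have hcop : p.Coprime h' := Nat.coprime_ordCompl hpp hr0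
  have hh'0 : h' ≠ 0 := (Nat.ordCompl_pos p hr0).ne'
  have hrr : p ^ r.factorization p * h' = r := Nat.ordProj_mul_ordCompl_eq_self r p
  -- `ψ₀ = χ^{h'}` and its image `R`, a cyclic `p`-group
  let ψ₀ : absoluteGaloisGroup K →* (ZMod q)ˣ := (powMonoidHom h').comp χ
  have hψ₀ : ∀ σ, ψ₀ σ = χ σ ^ h' := fun σ => rfl
  let R : Subgroup (ZMod q)ˣ := ψ₀.range
  have hPG : IsPGroup p R := by
    intro g
    refine ⟨r.factorization p, Subtype.ext ?_⟩
    obtain ⟨σ, hσ⟩ := g.2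
    rw [Subgroup.coe_pow, Subgroup.coe_one, ← hσ, hψ₀, ← pow_mul, mul_comm, hrr, hpow]
  obtain ⟨e, he⟩ := IsPGroup.iff_card.mp hPG
  haveI : IsCyclic R := inferInstance
  let ε : Multiplicative (ZMod (Nat.card R)) ≃* R := zmodCyclicMulEquiv inferInstance
  let η : ZMod (Nat.card R) ≃+* ZMod (p ^ e) := ZMod.ringEquivCongr he
  let Φ : absoluteGaloisGroup K →* Multiplicative (ZMod (Nat.card R)) :=
    ε.symm.toMonoidHom.comp ψ₀.rangeRestrict
  have hΦ : ∀ σ, Φ σ = ε.symm (ψ₀.rangeRestrict σ) := fun σ => rfl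
  let f : absoluteGaloisGroup K → ZMod (p ^ e) := fun σ => η (Multiplicative.toAdd (Φ σ))
  have hf : ∀ σ, f σ = η (Multiplicative.toAdd (Φ σ)) := fun σ => rfl
  -- `Φ` only depends on `χ`
  have hΦχ : ∀ σ τ, χ σ = χ τ → Φ σ = Φ τ := by
    intro σ τ hστ
    rw [hΦ, hΦ]
    congr 1
    apply Subtype.ext
    rw [MonoidHom.coe_rangeRestrict, MonoidHom.coe_rangeRestrict, hψ₀, hψ₀, hστ]
  -- locally constant
  have hlc : IsLocallyConstant f := by
    refine (IsLocallyConstant.iff_exists_open _).mpr fun σ => ?_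
    refine ⟨(fun x => σ⁻¹ * x) ⁻¹' (rootsOfUnityFixer K q : Set (absoluteGaloisGroup K)),
      (isOpen_rootsOfUnityFixer K q).preimage (by fun_prop), ?_, fun x hx => ?_⟩
    · change σ⁻¹ * σ ∈ rootsOfUnityFixer K q
      rw [inv_mul_cancel]
      exact one_mem _
    · change σ⁻¹ * x ∈ rootsOfUnityFixer K q at hx
      rw [rootsOfUnityFixer_eq_ker, MonoidHom.mem_ker, map_mul, map_inv, inv_mul_eq_one] at hx
      rw [hf, hf, hΦχ x σ hx.symm]
  -- surjective
  have hsurj : Surjective f := by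
    intro a
    obtain ⟨σ, hσ⟩ := ψ₀.rangeRestrict_surjective (ε (Multiplicative.ofAdd (η.symm a)))
    refine ⟨σ, ?_⟩
    rw [hf, hΦ, hσ, MulEquiv.symm_apply_apply, toAdd_ofAdd, RingEquiv.apply_symm_apply]
  let ψ : CyclicCharacter (absoluteGaloisGroup K) (p ^ e) :=
    { toFun := f
      map_mul' := fun σ τ => by rw [hf, hf, hf, map_mul, toAdd_mul, map_add]
      continuous_toFun := hlc.continuous
      surjective' := hsurj }
  have hψ : ∀ σ, ψ σ = f σ := fun σ => rfl
  refine ⟨e, ψ, fun σ hσ => ?_, fun σ a ha => ?_⟩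
  · -- `χ σ = 1 ⇒ ψ σ = 0`
    have h1 : Φ σ = 1 := by
      rw [← map_one Φ]
      exact hΦχ σ 1 (by rw [hσ, map_one])
    rw [hψ, hf, h1, toAdd_one, map_zero]
  · -- orders
    have h1 : addOrderOf (ψ σ) = orderOf (Φ σ) := by
      rw [hψ, hf]
      change addOrderOf (η.toAddMonoidHom (Multiplicative.toAdd (Φ σ))) = _
      rw [addOrderOf_injective η.toAddMonoidHom η.injective, ← orderOf_ofAdd_eq_addOrderOf, ofAdd_toAdd]
    rw [h1, hΦ, MulEquiv.orderOf_eq, ← Subgroup.orderOf_coe, MonoidHom.coe_rangeRestrict, hψ₀,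
      orderOf_pow' _ hh'0, ha, Nat.Coprime.gcd_eq_one (hcop.pow_left a), Nat.div_one]

end PPrimary

/-! ### §3. The mod-`q` cyclotomic character at the completions: inertia and Frobenius -/

section Local

variable (K : Type u) [Field K] [NumberField K] (q : ℕ) [NeZero q] [NeZero (q : K)]
  (v : HeightOneSpectrum (𝓞 K))

/-- **`χ_q` is unramified at `v ∤ q`, in the local currency**: the mod-`q` cyclotomic character
kills the image `res(I_{K_v})` of the inertia group of `Γ_{K_v}` for every finite place `v` with
`q ∉ v` (`res(I_{K_v}) = I_{𝔓₀}`, `inertia_adicCompletionPrime_eq_map_absInertia`, and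
`modNCyclotomicCharacter_eq_one_of_mem_inertia`).
Ref: Neukirch, *Algebraic Number Theory* (1999), Ch. II §7 Prop. (7.12)(i), §9 Prop. (9.6).
[cite: NeukirchANT1999, Ch. II §9 Prop. (9.6)] -/
theorem modNCyclotomicCharacter_absGaloisRestrict_eq_one_of_mem_absInertia (hv : (q : 𝓞 K) ∉ v.asIdeal)
    {σ : absoluteGaloisGroup (v.adicCompletion K)} (hσ : σ ∈ absInertia (v.adicCompletion K)) :
    modNCyclotomicCharacter K q (absGaloisRestrict K (v.adicCompletion K) σ) = 1 := by
  have hmem : absGaloisRestrict K (v.adicCompletion K) σ ∈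
      (adicCompletionPrime K v).inertia (absoluteGaloisGroup K) := by
    rw [inertia_adicCompletionPrime_eq_map_absInertia K v]
    exact Subgroup.mem_map_of_mem _ hσ
  exact modNCyclotomicCharacter_eq_one_of_mem_inertia
    (natCast_not_mem_of_mem_primesAbove K hv (adicCompletionPrime_mem_primesAbove K v)) hmem

/-- **`χ_q(Frob_v) = N(v) (mod q)` in the local currency**: for `v ∤ q` and an (absolute)
arithmetic Frobenius `φ ∈ Γ_{K_v}`, `χ_q(res φ) = q_v = #(𝓞_K/v)` (`res φ` is an arithmetic Frobenius
at `𝔓₀`, `isArithFrobAt_absGaloisRestrict_adicCompletionPrime_iff`, and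
`modNCyclotomicCharacter_eq_residueCard_of_isArithFrobAt`).
Ref: Neukirch, *Algebraic Number Theory* (1999), Ch. II §7 Prop. (7.12)(ii) (`φ : ζ ↦ ζ^q`), §9 Prop. (9.6).
[cite: NeukirchANT1999, Ch. II §7 Prop. (7.12)(ii)] -/
theorem coe_modNCyclotomicCharacter_absGaloisRestrict_of_isAbsArithFrob (hv : (q : 𝓞 K) ∉ v.asIdeal)
    {φ : absoluteGaloisGroup (v.adicCompletion K)} (hφ : IsAbsArithFrob φ) :
    ((modNCyclotomicCharacter K q (absGaloisRestrict K (v.adicCompletion K) φ) : (ZMod q)ˣ) : ZMod q) =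
      v.residueCard := by
  have hq' : residueFieldCard (v.adicCompletion K) = Nat.card (𝓞 K ⧸ v.asIdeal) := by
    rw [Automorphic.residueFieldCard_adicCompletion_eq, v.residueCard_eq_card_quotient]
  have hfrob := (isArithFrobAt_absGaloisRestrict_adicCompletionPrime_iff K v hq' φ).mpr hφ
  exact modNCyclotomicCharacter_eq_residueCard_of_isArithFrobAt (adicCompletionPrime_mem_primesAbove K v)
    (natCast_not_mem_of_mem_primesAbove K hv (adicCompletionPrime_mem_primesAbove K v)) hfrob

omit [NeZero q] [NeZero (q : K)] in
/-- The residue field of a finite place `v ∣ p` has `p^f` elements, `f ≥ 1` (it is a finite field of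
characteristic `p`; `f` is the inertia degree of Neukirch I (8.2)). [cite: NeukirchANT1999, Ch. I §8 Prop. (8.2)] -/
theorem exists_residueCard_eq_prime_pow {p : ℕ} (hp : p.Prime) (hpv : (p : 𝓞 K) ∈ v.asIdeal) :
    ∃ f : ℕ, 0 < f ∧ v.residueCard = p ^ f := by
  classical
  haveI := Fact.mk hp
  letI := Ideal.Quotient.field v.asIdeal
  letI := Fintype.ofFinite (𝓞 K ⧸ v.asIdeal)
  haveI : CharP (𝓞 K ⧸ v.asIdeal) p := by
    refine (CharP.charP_iff_prime_eq_zero hp).mpr ?_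
    rw [← map_natCast (Ideal.Quotient.mk v.asIdeal), Ideal.Quotient.eq_zero_iff_mem]
    exact hpv
  obtain ⟨n, -, hn⟩ := FiniteField.card (𝓞 K ⧸ v.asIdeal) p
  exact ⟨n, n.pos, by rw [HeightOneSpectrum.residueCard_eq_card_quotient, Nat.card_eq_fintype_card, hn]⟩

/-- **The order of `χ_q(Frob_v)` for `v ∣ p`.**  If `p` has order `p^T` in `(ℤ/q)^×`, `v ∣ p` is a
finite place (so `v ∤ q`) with `N(v) ≤ B`, and `φ ∈ Γ_{K_v}` is an arithmetic Frobenius, then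
`χ_q(res φ) = N(v) = p^{f_v}` has order `p^a` with `a ≥ T − B` (indeed `a = T − v_p(f_v)` and
`v_p(f_v) < f_v < N(v) ≤ B`): the decomposition group of `v` in the `p`-part of `K(μ_q)/K` is large
when `T` is.  (Elementary; the quantitative input of Tate's choice of the auxiliary prime `q`.)
[cite: CasselsFrohlichANT1967, Ch. VII §10.5 (Step 3)] -/
theorem exists_orderOf_modNCyclotomicCharacter_absGaloisRestrict_eq_prime_pow (hv : (q : 𝓞 K) ∉ v.asIdeal)
    {p : ℕ} (hp : p.Prime) (hpv : (p : 𝓞 K) ∈ v.asIdeal) {T : ℕ} (hT : orderOf (p : ZMod q) = p ^ T)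
    {B : ℕ} (hB : v.residueCard ≤ B) {φ : absoluteGaloisGroup (v.adicCompletion K)}
    (hφ : IsAbsArithFrob φ) :
    ∃ a : ℕ, T ≤ a + B ∧
      orderOf (modNCyclotomicCharacter K q (absGaloisRestrict K (v.adicCompletion K) φ)) = p ^ a := by
  obtain ⟨f, hf0, hf⟩ := exists_residueCard_eq_prime_pow K v hp hpv
  have hval := coe_modNCyclotomicCharacter_absGaloisRestrict_of_isAbsArithFrob K q v hv hφ
  rw [← orderOf_units, hval, hf, Nat.cast_pow, orderOf_pow' _ hf0.ne', hT]
  obtain ⟨j, hjT, hj⟩ := (Nat.dvd_prime_pow hp).mp (Nat.gcd_dvd_left (p ^ T) f)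
  have h1 : p ^ j ∣ f := hj ▸ Nat.gcd_dvd_right _ _
  have h2 : p ^ j ≤ f := Nat.le_of_dvd hf0 h1
  have h3 : j < p ^ j := Nat.lt_pow_self hp.one_lt
  have h4 : f < p ^ f := Nat.lt_pow_self hp.one_lt
  rw [hf] at hB
  refine ⟨T - j, by omega, ?_⟩
  rw [hj, Nat.pow_div hjT hp.pos]

end Local


end Literature.NumberTheory.GaloisCohomology

end
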